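import Summits.QuantumFields.BalabanUV.Beta.KernelWardHColumnStep

/-!
# `BalabanUV.Beta.KernelWardHColumnFixed` — binder row D1, hW class: THE ℋ-COLUMN WARD LAW FROM RULE AME AGAINST ANY SPREAD PROJECTOR `E` THAT
# FIXES THE PURE-GAUGE TEST KERNEL (`KernelWardHColumn` ∕ `KernelWardHColumnStep` with the comb coordinate projector `axEc ρ N` GENERALISED to `E`)

HONEST FRAMING (cell charter, verbatim): «discharging BetaPertH makes Balaban's UV stability UNCONDITIONAL — a real constructive-QFT result; it is
NOT the continuum limit and NOT the Clay problem.»  HONEST DEPENDENCY: continuum YM on T⁴ ⇐ BetaPertH ∧ nine spine estimates (0/9 proved);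
BetaPertH ⇐ (D1) ∧ (D4) ∧ CAP+tail; G-an2-4 gates asym, D1 and NE2/3/4.
DERIVED cell leaf (β sub-cell, BINDER-OWNERS row D1 OWNER `b2b-balaban-beta-an2`, gen 27; RULING R-D1-g27-2: the ℋ-column Ward socket `hH` of the in-tree
(0.4) root `RowD1JointEndSym` is literal-INDEPENDENT, so discharging it is binder work on an existing row under the coordinator's ruling e34b3e0c (1), not
a new Support leaf; the GO lapses if cap-ref ∕ coordinator read (0) as covering it).  No statement of Bałaban's papers, no `[cite:]`, no `Prop` fact; two
data `def`s (`blockInd`, `pgTest`: the block indicator and the PURE-GAUGE TEST KERNEL which `KernelWardHColumn(Step)` build as local `set`s — made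
definitions so that the projector-generic law can be STATED; consumed by `KernelWardHColumnSym`).  Discharges NO binder of the wall.  NOT D1, NOT
`BetaPertH`, NOT continuum, NOT Clay.
WHAT ([folklore] kernel bookkeeping; «not in print; our proof attempt»).  §1 `blockInd N y`, `pgTest N y` (single non-zero column `(dz 1_{B(y)} ; 0)` at
`(0, inl 0)`) with `loc_pgTest`, `fcol_pgTest`, `mcol_pgTest`, `summable_blockInd`, `blockSum_blockInd'`, `pgTest_eq_gaugeWt`.  §2 **`colH_ward_of_AME_fix`**
(`𝕄 = bhK N`, constant `(N^{d+1})⁻¹`), **`colH_ward_of_AME_step_fix`** (`𝕄 = bhKStep d N (j+1)`, `(stepScale d N (j+1)·N^{d+1})⁻¹`), **`colH_ward_of_AME_all_fix`**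
(all `j`, `cH j := (stepScale d N j · N^{d+1})⁻¹`): for a spread `G`, a spread `E` with rule AME `(G ∘ 𝕄) ∘ E = E` and `E ∘ pgTest N y = pgTest N y`,
`Σ_μ (colH G N μ (y − e_μ) κ′ u − colH G N μ y κ′ u) = cH · gaugeWt N y κ′ u`.  The proofs are leaf-07's two proofs VERBATIM after their step (b)
(«`axEc` fixes `T`»), which is exactly the hypothesis `hfix` here; `KernelWardHColumn(Step)`'s theorems are the instances `E := axEc ρ N`.
Provenance: β sub-cell, unit beta-an2 gen 27, 2026-08-21 (v1); over `KernelWardHColumn`∕`KernelWardHColumnStep` (leaf-07), `BorderedHessian*` (an2),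
`KernelWardRelative` (an1, `gaugeWt`) BY NAME; no existing file touched.
-/

open Finset Filter
open scoped BigOperators
open Literature.Probability.LatticeModels (TorusSite Torus.proj Torus.proj_apply)
open Literature.MathematicalPhysics.QuantumFieldTheory
open Literature.MathematicalPhysics.QuantumFieldTheory.Balaban1983to89
open Literature.MathematicalPhysics.QuantumFieldTheory.Balaban1983to89.Beta
open B12Sec2to5 (l1 l1_nonneg)
open ExpKernelCalculus (MKer Decays BiLoc comp)
open AffineAveraging (Form0 Form1 Form2 box toSite dz curv curvAdj contourSum blockSum curv_dz contourSum_dz)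
open AffineReproduction (contourSumAdj)
open AveragingContours (blk blk_block off off_mem_box blk_add_off)
open AveragingWardStencils (b6UnitVec_eq)
open LatticeForm (quo)
open KKTFluctuationEnergy (lip0 lip1 lip1_dz summable_mul_of_bdd')
open DecimatedMomentLimit (summable_of_decay510)
open KernelSpecInstance (wΦ decay_wΦ)
open OneStepResolventKernel (Fib KInv quo_zsmul proj_zsmul)
open OneStepKernelFamily (KInvStep colH)
open AxialProjector (zsmul_blk_le lt_zsmul_blk_add)
open ResolventComposition (tsum_sublattice₀)
open Summit.QuantumFields.BalabanUV.Beta.TameKernelCalculus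
open Summit.QuantumFields.BalabanUV.Beta.ChartConjugationRelative (RelInv spr_comp)
open Summit.QuantumFields.BalabanUV.Beta.AxialDressingRooted (one_le_of_neZero)
open Summit.QuantumFields.BalabanUV.Beta.BorderedHessian (bhK spr_bhK bhKStep bhKStep_zero spr_bhKStep stepScale stepScale_ne_zero
  fcol mcol fcol_apply mcol_apply comp_bhK_inl comp_bhK_inr comp_bhKStep_succ_inl comp_bhKStep_succ_inr exists_abs_wΦ_le codiff₁_wΦ_right)
open Summit.QuantumFields.BalabanUV.Beta.KernelWardRelative (gaugeWt)
open Summit.QuantumFields.BalabanUV.Beta.KernelWardHColumn (loc_of_bdd_support l1_sub_zsmul_le_of_blk blockSum_blockInd)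

namespace Summit.QuantumFields.BalabanUV.Beta.KernelWardHColumnFixed

noncomputable section

variable {d : ℕ}

/-! ## §1 The block indicator and the pure-gauge test kernel -/

section Test

variable {N : ℕ}

/-- [our object] The indicator of the block with coarse label `y`. -/
def blockInd (N : ℕ) (y : Fin (d + 1) → ℤ) : Form0 (d + 1) ℝ := fun v => if blk N v = y then 1 else 0

/-- [folklore] `blockInd` unfolded. -/
theorem blockInd_apply (N : ℕ) (y v : Fin (d + 1) → ℤ) : blockInd N y v = if blk N v = y then 1 else 0 := rfl

/-- [folklore] `|1_{B(y)}| ≤ 1`. -/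
theorem abs_blockInd_le (N : ℕ) (y v : Fin (d + 1) → ℤ) : |blockInd N y v| ≤ 1 := by
  rw [blockInd_apply]; split_ifs <;> simp

open Classical in
/-- [our object] **THE PURE-GAUGE TEST KERNEL**: single non-zero column `(0, inl 0)`, equal to `(dz 1_{B(y)} ; 0)` (field legs: the pure gauge of the
block indicator; multiplier legs: `0`). -/
def pgTest (N : ℕ) (y : Fin (d + 1) → ℤ) : MKer (d + 1) (Fib d) := fun z z' f b =>
  if z' = 0 ∧ b = Sum.inl 0 then
    (match f with
      | Sum.inl κ => blockInd N y (z + AffineAveraging.unitVec κ) - blockInd N y z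
      | Sum.inr _ => 0)
  else 0

/-- [folklore] Field rows of the test kernel. -/
theorem pgTest_inl (y z z' : Fin (d + 1) → ℤ) (κ : Fin (d + 1)) (b : Fib d) :
    pgTest N y z z' (Sum.inl κ) b = if z' = 0 ∧ b = Sum.inl 0 then blockInd N y (z + AffineAveraging.unitVec κ) - blockInd N y z else 0 := by
  unfold pgTest; split_ifs <;> rfl

/-- [folklore] Multiplier rows of the test kernel vanish. -/
theorem pgTest_inr (y z z' : Fin (d + 1) → ℤ) (m : Fin (d + 1)) (b : Fib d) : pgTest N y z z' (Sum.inr m) b = 0 := by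
  unfold pgTest; split_ifs <;> rfl

/-- [folklore] `|pgTest| ≤ 2`. -/
theorem abs_pgTest_le (y z z' : Fin (d + 1) → ℤ) (a b : Fib d) : |pgTest N y z z' a b| ≤ 2 := by
  rcases a with κ | m
  · rw [pgTest_inl]
    split_ifs
    · exact (abs_sub _ _).trans (by linarith [abs_blockInd_le N y (z + AffineAveraging.unitVec κ), abs_blockInd_le N y z])
    · norm_num
  · rw [pgTest_inr, abs_zero]; norm_num

/-- [folklore] The test kernel is localised (bounded, bounded support), hence tame. -/
theorem loc_pgTest (hN : 1 ≤ N) (y : Fin (d + 1) → ℤ) : Loc (pgTest N y) := by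
  refine loc_of_bdd_support ((N : ℤ) • y) 0 (B := 2) (R := (d + 1 : ℝ) * N) (abs_pgTest_le y) (fun z z' a b hne => ?_)
  rcases a with κ | m
  · rw [pgTest_inl] at hne
    by_cases hc : z' = 0 ∧ b = Sum.inl 0
    · rw [if_pos hc] at hne
      have hl0 : l1 (z' - 0 : Fin (d + 1) → ℤ) = 0 := by rw [hc.1]; simp [l1]
      rw [hl0, add_zero]
      have hor : blk N z = y ∨ blk N (z + AffineAveraging.unitVec κ) = y := by
        by_contra hno
        have hn1 : ¬ blk N z = y := fun h => hno (Or.inl h)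
        have hn2 : ¬ blk N (z + AffineAveraging.unitVec κ) = y := fun h => hno (Or.inr h)
        apply hne
        simp only [blockInd_apply, if_neg hn1, if_neg hn2, sub_self]
      exact l1_sub_zsmul_le_of_blk hN hor
    · rw [if_neg hc] at hne; exact absurd rfl hne
  · rw [pgTest_inr] at hne; exact absurd rfl hne

/-- [folklore] The field column `(0, inl 0)` of the test kernel is the pure gauge `dz 1_{B(y)}`. -/
theorem fcol_pgTest (y : Fin (d + 1) → ℤ) : fcol (pgTest N y) 0 (Sum.inl 0) = dz (blockInd N y) := by
  funext l v
  rw [fcol_apply, pgTest_inl, if_pos ⟨rfl, rfl⟩]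
  rfl

/-- [folklore] The multiplier column `(0, inl 0)` of the test kernel vanishes. -/
theorem mcol_pgTest [NeZero N] (y : Fin (d + 1) → ℤ) : mcol N (pgTest N y) 0 (Sum.inl 0) = 0 := by
  funext l v
  rw [mcol_apply, pgTest_inr]
  rfl

/-- [folklore] `1_{B(y)}` is finitely supported, hence summable. -/
theorem summable_blockInd (hN : 1 ≤ N) (y : Fin (d + 1) → ℤ) : Summable (blockInd N y) := by
  refine summable_of_ne_finset_zero (s := (box (d + 1) N).image fun b => (N : ℤ) • y + toSite b) fun v hv => ?_
  rw [blockInd_apply, if_neg]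
  intro hvy
  apply hv
  refine Finset.mem_image.2 ⟨off N v, off_mem_box hN v, ?_⟩
  rw [← hvy]
  exact blk_add_off hN v

/-- [folklore] The block sum of `1_{B(y)}` is `N^{d+1}·δ_y` (`KernelWardHColumn.blockSum_blockInd`). -/
theorem blockSum_blockInd' (y q : Fin (d + 1) → ℤ) : blockSum N (blockInd N y) q = if q = y then (N : ℝ) ^ (d + 1) else 0 :=
  blockSum_blockInd y q

/-- [folklore] The entry `(u, 0, inl κ′, inl 0)` of the test kernel is the pure-gauge weight `gaugeWt N y κ′ u`. -/
theorem pgTest_eq_gaugeWt (y u : Fin (d + 1) → ℤ) (κ' : Fin (d + 1)) : pgTest N y u 0 (Sum.inl κ') (Sum.inl 0) = gaugeWt N y κ' u := by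
  rw [pgTest_inl, if_pos ⟨rfl, rfl⟩]
  simp only [blockInd_apply, gaugeWt, b6UnitVec_eq]

end Test

/-! ## §2 The ℋ-column Ward law from rule AME against ANY spread projector fixing the test kernel -/

section Generic

variable {N : ℕ} [NeZero N] {G E : MKer (d + 1) (Fib d)}

open Classical in
/-- [folklore] **THE ℋ-COLUMN WARD LAW FROM RULE AME, PROJECTOR-GENERIC, `j = 0`**: if `G`, `E` are spread, `(G ∘ bhK N) ∘ E = E` and
`E ∘ pgTest N y = pgTest N y`, then `Σ_μ (colH G N μ (y − e_μ) κ′ u − colH G N μ y κ′ u) = (N^{d+1})⁻¹ · gaugeWt N y κ′ u`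
(`KernelWardHColumn.colH_ward_of_AME` with `axEc ρ N ↦ E`; its proof verbatim from step (c) on). -/
theorem colH_ward_of_AME_fix (hG : Spr G) (hE : Spr E) (hAME : comp (comp G (bhK N)) E = E) {y : Fin (d + 1) → ℤ}
    (hfix : comp E (pgTest N y) = pgTest N y) (κ' : Fin (d + 1)) (u : Fin (d + 1) → ℤ) :
    ∑ μ, (colH G N μ (y - B6BondElimination.unitVec μ) κ' u - colH G N μ y κ' u) = ((N : ℝ) ^ (d + 1))⁻¹ * gaugeWt N y κ' u := by
  have hN : 1 ≤ N := one_le_of_neZero N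
  have hN0 : ((N : ℝ) ^ (d + 1)) ≠ 0 := pow_ne_zero _ (by exact_mod_cast (NeZero.ne N))
  have hTloc : Loc (pgTest N y) := loc_pgTest hN y
  -- (c) the action of the straight bordered Hessian on the test kernel: column `(0, inl 0)`
  have hM_inl : ∀ t l, comp (bhK N) (pgTest N y) t 0 (Sum.inl l) (Sum.inl 0) = 0 := by
    intro t l
    rw [comp_bhK_inl, fcol_pgTest, mcol_pgTest, curv_dz]
    simp [curvAdj, contourSumAdj]
  have hM_inr : ∀ t m, comp (bhK N) (pgTest N y) t 0 (Sum.inr m) (Sum.inl 0) =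
      if Torus.proj N t = 0 then
        ((if quo N t + AffineAveraging.unitVec m = y then (N : ℝ) ^ (d + 1) else 0) - (if quo N t = y then (N : ℝ) ^ (d + 1) else 0))
      else 0 := by
    intro t m
    rw [comp_bhK_inr, fcol_pgTest, contourSum_dz]
    by_cases ht : Torus.proj N t = 0
    · rw [if_pos ht, if_pos ht]
      simp only [dz]
      rw [blockSum_blockInd', blockSum_blockInd']
    · rw [if_neg ht, if_neg ht]
  -- (d) contract rule AME with the test kernel and reassociate
  have hM : Spr (bhK (d := d) N) := spr_bhK hN
  have h1 : comp (comp (comp G (bhK N)) E) (pgTest N y) = pgTest N y := by rw [hAME, hfix]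
  rw [← comp_assoc_tame (spr_comp hG hM).tame hE.tame hTloc.tame, hfix, ← comp_assoc_tame hG.tame hM.tame hTloc.tame] at h1
  -- (e) read the entry `(u, 0, inl κ′, inl 0)`
  have h2 := congrFun (congrFun (congrFun (congrFun h1 u) 0) (Sum.inl κ')) (Sum.inl 0)
  have hR : pgTest N y u 0 (Sum.inl κ') (Sum.inl 0) = gaugeWt N y κ' u := pgTest_eq_gaugeWt y u κ'
  -- the left-hand side: only the coarse multiplier legs of `G` see the (non-zero part of the) image
  set c : (Fin (d + 1) → ℤ) → ℝ := fun q => if q = y then (N : ℝ) ^ (d + 1) else 0 with hc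
  have hL : comp G (comp (bhK N) (pgTest N y)) u 0 (Sum.inl κ') (Sum.inl 0) =
      ∑' q : Fin (d + 1) → ℤ, ∑ m : Fin (d + 1), G u ((N : ℤ) • q) (Sum.inl κ') (Sum.inr m) * (c (q + AffineAveraging.unitVec m) - c q) := by
    show (∑' t, ∑ g : Fib d, G u t (Sum.inl κ') g * comp (bhK N) (pgTest N y) t 0 g (Sum.inl 0)) = _
    refine tsum_sublattice₀ N _ _ (fun t ht => ?_) (fun q => ?_)
    · rw [Fintype.sum_sum_type]
      simp only [hM_inl, hM_inr, if_neg ht, mul_zero, Finset.sum_const_zero, zero_add]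
    · have hq : Torus.proj N ((N : ℤ) • q) = 0 := proj_zsmul q
      rw [Fintype.sum_sum_type]
      simp only [hM_inl, hM_inr, if_pos hq, quo_zsmul, mul_zero, Finset.sum_const_zero, zero_add, hc]
  -- evaluate the finitely supported coarse sum
  have hS : ∑' q : Fin (d + 1) → ℤ, ∑ m : Fin (d + 1), G u ((N : ℤ) • q) (Sum.inl κ') (Sum.inr m) * (c (q + AffineAveraging.unitVec m) - c q) =
      (N : ℝ) ^ (d + 1) * ∑ m, (colH G N m (y - B6BondElimination.unitVec m) κ' u - colH G N m y κ' u) := by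
    set S : Finset (Fin (d + 1) → ℤ) := insert y (Finset.univ.image fun m : Fin (d + 1) => y - AffineAveraging.unitVec m) with hSdef
    have hyS : y ∈ S := Finset.mem_insert_self _ _
    have hymS : ∀ m, y - AffineAveraging.unitVec m ∈ S := fun m =>
      Finset.mem_insert_of_mem (Finset.mem_image.2 ⟨m, Finset.mem_univ _, rfl⟩)
    rw [tsum_eq_sum (s := S)]
    · -- swap the two finite sums and evaluate the indicators
      rw [Finset.sum_comm, Finset.mul_sum]
      refine Finset.sum_congr rfl fun m _ => ?_
      have e1 : ∀ q, c (q + AffineAveraging.unitVec m) = if q = y - AffineAveraging.unitVec m then (N : ℝ) ^ (d + 1) else 0 := by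
        intro q
        simp only [hc]
        by_cases hq : q = y - AffineAveraging.unitVec m
        · rw [if_pos (by rw [hq]; abel), if_pos hq]
        · rw [if_neg (fun h => hq (by rw [← h]; abel)), if_neg hq]
      have e2 : ∀ q, G u ((N : ℤ) • q) (Sum.inl κ') (Sum.inr m) * (c (q + AffineAveraging.unitVec m) - c q) =
          (if q = y - AffineAveraging.unitVec m then G u ((N : ℤ) • q) (Sum.inl κ') (Sum.inr m) * (N : ℝ) ^ (d + 1) else 0) -
            (if q = y then G u ((N : ℤ) • q) (Sum.inl κ') (Sum.inr m) * (N : ℝ) ^ (d + 1) else 0) := by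
        intro q
        rw [e1]
        simp only [hc]
        split_ifs <;> ring
      rw [Finset.sum_congr rfl (fun q _ => e2 q), Finset.sum_sub_distrib, Finset.sum_ite_eq' S (y - AffineAveraging.unitVec m),
        Finset.sum_ite_eq' S y, if_pos (hymS m), if_pos hyS]
      simp only [colH, b6UnitVec_eq]
      ring
    · intro q hq
      refine Finset.sum_eq_zero fun m _ => ?_
      have hqy : q ≠ y := fun h => hq (h ▸ hyS)
      have hqm : q + AffineAveraging.unitVec m ≠ y := by
        intro h
        apply hq
        have : q = y - AffineAveraging.unitVec m := by rw [← h]; abel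
        rw [this]; exact hymS m
      simp only [hc, if_neg hqy, if_neg hqm, sub_self, mul_zero]
  -- assemble
  rw [hL, hS, hR] at h2
  rw [← h2, ← mul_assoc, inv_mul_cancel₀ hN0, one_mul]

open Classical in
/-- [folklore] **THE ℋ-COLUMN WARD LAW FROM RULE AME, PROJECTOR-GENERIC, STEP `j + 1`**: if `G`, `E` are spread,
`(G ∘ bhKStep d N (j+1)) ∘ E = E` and `E ∘ pgTest N y = pgTest N y`, then
`Σ_μ (colH G N μ (y − e_μ) κ′ u − colH G N μ y κ′ u) = (stepScale d N (j+1) · N^{d+1})⁻¹ · gaugeWt N y κ′ u`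
(`KernelWardHColumnStep.colH_ward_of_AME_step` with `axEc ρ N ↦ E`; its proof verbatim from step (c) on). -/
theorem colH_ward_of_AME_step_fix (j : ℕ) (hG : Spr G) (hE : Spr E) (hAME : comp (comp G (bhKStep d N (j + 1))) E = E)
    {y : Fin (d + 1) → ℤ} (hfix : comp E (pgTest N y) = pgTest N y) (κ' : Fin (d + 1)) (u : Fin (d + 1) → ℤ) :
    ∑ μ, (colH G N μ (y - B6BondElimination.unitVec μ) κ' u - colH G N μ y κ' u) =
      (stepScale d N (j + 1) * (N : ℝ) ^ (d + 1))⁻¹ * gaugeWt N y κ' u := by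
  have hN : 1 ≤ N := one_le_of_neZero N
  have hN0 : ((N : ℝ) ^ (d + 1)) ≠ 0 := pow_ne_zero _ (by exact_mod_cast (NeZero.ne N))
  have hTloc : Loc (pgTest N y) := loc_pgTest hN y
  have hT_le : ∀ z z' a b, |pgTest N y z z' a b| ≤ 2 := abs_pgTest_le y
  -- the value-Hessian rows kill the pure gauge: `Σ' Σ_l wΦ κ l (t − ·) · (dz 1_B)_l = ⟨codiff₁ wΦ(κ,·,t−·), 1_B⟩ = 0`
  obtain ⟨Cw, hCw⟩ := exists_abs_wΦ_le (N := N ^ (j + 1)) (d := d)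
  obtain ⟨δ, C, hδ, hdec⟩ := decay_wΦ (N := N ^ (j + 1)) (d := d)
  have hX : ∀ (t : Fin (d + 1) → ℤ) (κ : Fin (d + 1)), Summable fun y' => ∑ l : Fin (d + 1),
      wΦ (N := N ^ (j + 1)) κ l (t - y') * pgTest N y y' 0 (Sum.inl l) (Sum.inl 0) := fun t κ =>
    summable_sum fun l _ => summable_mul_of_bdd' (M := 2)
      ((summable_of_decay510 hδ (hdec κ l)).comp_injective sub_right_injective) (fun y' => hT_le y' 0 (Sum.inl l) (Sum.inl 0))
  have hkill : ∀ (t : Fin (d + 1) → ℤ) (κ : Fin (d + 1)),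
      (∑' y', ∑ l : Fin (d + 1), wΦ (N := N ^ (j + 1)) κ l (t - y') * pgTest N y y' 0 (Sum.inl l) (Sum.inl 0)) = 0 := by
    intro t κ
    have e : (∑' y', ∑ l : Fin (d + 1), wΦ (N := N ^ (j + 1)) κ l (t - y') * pgTest N y y' 0 (Sum.inl l) (Sum.inl 0)) =
        lip1 (fun l y' => wΦ (N := N ^ (j + 1)) κ l (t - y')) (dz (blockInd N y)) := by
      rw [← fcol_pgTest]; rfl
    rw [e, lip1_dz (M := Cw) (fun l y' => hCw κ l (t - y')) (summable_blockInd hN y), codiff₁_wΦ_right]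
    simp [lip0]
  have hM_inl : ∀ t l, comp (bhKStep d N (j + 1)) (pgTest N y) t 0 (Sum.inl l) (Sum.inl 0) = 0 := by
    intro t l
    rw [comp_bhKStep_succ_inl j (pgTest N y) t 0 l (Sum.inl 0) (hX t l), hkill, mcol_pgTest]
    simp [contourSumAdj]
  have hM_inr : ∀ t m, comp (bhKStep d N (j + 1)) (pgTest N y) t 0 (Sum.inr m) (Sum.inl 0) =
      stepScale d N (j + 1) * (if Torus.proj N t = 0 then
        ((if quo N t + AffineAveraging.unitVec m = y then (N : ℝ) ^ (d + 1) else 0) - (if quo N t = y then (N : ℝ) ^ (d + 1) else 0))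
      else 0) := by
    intro t m
    rw [comp_bhKStep_succ_inr, fcol_pgTest, contourSum_dz]
    by_cases ht : Torus.proj N t = 0
    · rw [if_pos ht, if_pos ht]
      simp only [dz]
      rw [blockSum_blockInd', blockSum_blockInd']
    · rw [if_neg ht, if_neg ht]
  -- (d) contract rule AME with the test kernel and reassociate
  have hM : Spr (bhKStep d N (j + 1)) := spr_bhKStep (j + 1)
  have h1 : comp (comp (comp G (bhKStep d N (j + 1))) E) (pgTest N y) = pgTest N y := by rw [hAME, hfix]
  rw [← comp_assoc_tame (spr_comp hG hM).tame hE.tame hTloc.tame, hfix, ← comp_assoc_tame hG.tame hM.tame hTloc.tame] at h1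
  -- (e) read the entry `(u, 0, inl κ′, inl 0)`
  have h2 := congrFun (congrFun (congrFun (congrFun h1 u) 0) (Sum.inl κ')) (Sum.inl 0)
  have hR : pgTest N y u 0 (Sum.inl κ') (Sum.inl 0) = gaugeWt N y κ' u := pgTest_eq_gaugeWt y u κ'
  set c : (Fin (d + 1) → ℤ) → ℝ := fun q => if q = y then (N : ℝ) ^ (d + 1) else 0 with hc
  have hL : comp G (comp (bhKStep d N (j + 1)) (pgTest N y)) u 0 (Sum.inl κ') (Sum.inl 0) =
      ∑' q : Fin (d + 1) → ℤ, ∑ m : Fin (d + 1), G u ((N : ℤ) • q) (Sum.inl κ') (Sum.inr m) *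
        (stepScale d N (j + 1) * (c (q + AffineAveraging.unitVec m) - c q)) := by
    show (∑' t, ∑ g : Fib d, G u t (Sum.inl κ') g * comp (bhKStep d N (j + 1)) (pgTest N y) t 0 g (Sum.inl 0)) = _
    refine tsum_sublattice₀ N _ _ (fun t ht => ?_) (fun q => ?_)
    · rw [Fintype.sum_sum_type]
      simp only [hM_inl, hM_inr, if_neg ht, mul_zero, Finset.sum_const_zero, zero_add]
    · have hq : Torus.proj N ((N : ℤ) • q) = 0 := proj_zsmul q
      rw [Fintype.sum_sum_type]
      simp only [hM_inl, hM_inr, if_pos hq, quo_zsmul, mul_zero, Finset.sum_const_zero, zero_add, hc]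
  have hS : ∑' q : Fin (d + 1) → ℤ, ∑ m : Fin (d + 1), G u ((N : ℤ) • q) (Sum.inl κ') (Sum.inr m) *
        (stepScale d N (j + 1) * (c (q + AffineAveraging.unitVec m) - c q)) =
      (stepScale d N (j + 1) * (N : ℝ) ^ (d + 1)) * ∑ m, (colH G N m (y - B6BondElimination.unitVec m) κ' u - colH G N m y κ' u) := by
    set S : Finset (Fin (d + 1) → ℤ) := insert y (Finset.univ.image fun m : Fin (d + 1) => y - AffineAveraging.unitVec m) with hSdef
    have hyS : y ∈ S := Finset.mem_insert_self _ _
    have hymS : ∀ m, y - AffineAveraging.unitVec m ∈ S := fun m =>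
      Finset.mem_insert_of_mem (Finset.mem_image.2 ⟨m, Finset.mem_univ _, rfl⟩)
    rw [tsum_eq_sum (s := S)]
    · rw [Finset.sum_comm, Finset.mul_sum]
      refine Finset.sum_congr rfl fun m _ => ?_
      have e1 : ∀ q, c (q + AffineAveraging.unitVec m) = if q = y - AffineAveraging.unitVec m then (N : ℝ) ^ (d + 1) else 0 := by
        intro q
        simp only [hc]
        by_cases hq : q = y - AffineAveraging.unitVec m
        · rw [if_pos (by rw [hq]; abel), if_pos hq]
        · rw [if_neg (fun h => hq (by rw [← h]; abel)), if_neg hq]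
      have e2 : ∀ q, G u ((N : ℤ) • q) (Sum.inl κ') (Sum.inr m) * (stepScale d N (j + 1) * (c (q + AffineAveraging.unitVec m) - c q)) =
          (if q = y - AffineAveraging.unitVec m then G u ((N : ℤ) • q) (Sum.inl κ') (Sum.inr m) * (stepScale d N (j + 1) * (N : ℝ) ^ (d + 1)) else 0) -
            (if q = y then G u ((N : ℤ) • q) (Sum.inl κ') (Sum.inr m) * (stepScale d N (j + 1) * (N : ℝ) ^ (d + 1)) else 0) := by
        intro q
        rw [e1]
        simp only [hc]
        split_ifs <;> ring
      rw [Finset.sum_congr rfl (fun q _ => e2 q), Finset.sum_sub_distrib, Finset.sum_ite_eq' S (y - AffineAveraging.unitVec m),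
        Finset.sum_ite_eq' S y, if_pos (hymS m), if_pos hyS]
      simp only [colH, b6UnitVec_eq]
      ring
    · intro q hq
      refine Finset.sum_eq_zero fun m _ => ?_
      have hqy : q ≠ y := fun h => hq (h ▸ hyS)
      have hqm : q + AffineAveraging.unitVec m ≠ y := by
        intro h
        apply hq
        have : q = y - AffineAveraging.unitVec m := by rw [← h]; abel
        rw [this]; exact hymS m
      simp only [hc, if_neg hqy, if_neg hqm, sub_self, mul_zero]
  rw [hL, hS, hR] at h2
  have hs0 : stepScale d N (j + 1) * (N : ℝ) ^ (d + 1) ≠ 0 := mul_ne_zero (stepScale_ne_zero (j + 1)) hN0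
  rw [← h2, ← mul_assoc, inv_mul_cancel₀ hs0, one_mul]

/-- [folklore] **ALL STEPS AT ONCE, PROJECTOR-GENERIC**: one constant family `cH j := (stepScale d N j · N^{d+1})⁻¹` (`stepScale d N 0 = 1`). -/
theorem colH_ward_of_AME_all_fix {Gs : ℕ → MKer (d + 1) (Fib d)} (hG : ∀ j, Spr (Gs j)) (hE : Spr E)
    (hAME : ∀ j, comp (comp (Gs j) (bhKStep d N j)) E = E) (hfix : ∀ y, comp E (pgTest N y) = pgTest N y)
    (j : ℕ) (y : Fin (d + 1) → ℤ) (κ' : Fin (d + 1)) (u : Fin (d + 1) → ℤ) :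
    ∑ μ, (colH (Gs j) N μ (y - B6BondElimination.unitVec μ) κ' u - colH (Gs j) N μ y κ' u) =
      (stepScale d N j * (N : ℝ) ^ (d + 1))⁻¹ * gaugeWt N y κ' u := by
  cases j with
  | zero =>
    have h0 : stepScale d N 0 = 1 := by simp [stepScale]
    rw [h0, one_mul]
    exact colH_ward_of_AME_fix (hG 0) hE (by simpa only [bhKStep_zero] using hAME 0) (hfix y) κ' u
  | succ j => exact colH_ward_of_AME_step_fix j (hG (j + 1)) hE (hAME (j + 1)) (hfix y) κ' u

end Generic

end

end Summit.QuantumFields.BalabanUV.Beta.KernelWardHColumnFixed
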